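import Summits.HodgeConjecture.HodgeConjecture.Theorems.VHCAbelianSchemesRoadSecantQuotientAnchorPinnedDefs
import Summits.HodgeConjecture.HodgeConjecture.Theorems.VHCAbelianSchemesRoadServedFibreAnchors
import HarnessLib

/-!
# Road b02 (`VHCAbelianSchemesRoad`, D-0059) — THE PINNED `(6,3)` RESIDUAL (stub 2b″ of skeleton v3.1 of crux
# `SemiregularSheafRepresentativesTwAtDiag`, item stmt-HodgeConjecture-19787): FIRST REDUCTION (a per-variety sandwich) and CHEAPEST OBSTRUCTION

research route conditional on HC_CM; not a corollary; Q11.4-sentence-2 already refuted in dim ≥ 3.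

FACT-FREE; `HC_CM` nowhere; door- and anchor-generic in §1–§2, instantiated at the pinned secant–quotient data `(𝔄^pin, 𝔖^pin)` of
`VHCAbelianSchemesRoadSecantQuotientAnchorPinnedDefs` (p512578) in §3–§5. The stub `stub_residual_63_secantQuotientPinned : ∀ C,
SecantQuotientResidual63Pinned C` (T3 PLAN-ONLY designate of record) is NOT restated, claimed or weakened: every theorem IMPLIES it from a named
per-variety statement or DRAWS a named consequence from it (ring2-b03 on director-hodge g7's row (5), 2026-08-27, under LEAD 153).

FIRST REDUCTION (the pencil quantifier removed, up to a displayed slack). The residual `LefAtExceptionalRegimeAtUnder 𝒪 n p (¬ HasServedFibre …)`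
asks, on every one-parameter abelian scheme `(f, W, s₀)` of the cell's shape WITHOUT an `(𝔄, 𝔖)`-served fibre, for an `𝒪`-datum at SOME fibre.
* §1 SUFFICIENT (`under_not_hasServedFibre_of_anchoredCarrierAt_offServed`): place the datum AT `s₀`, where `W` is algebraic by hypothesis,
  polarised by the relative hyperplane class `Θ` (`exists_forall_isPolarizationClass_map_fiberι`); no `(𝔄, 𝔖)`-served fibre ⟹ `W|_{s₀}` is OFF
  the served set of `(𝒳_{s₀}, Θ|)`. So RESIDUAL ⟸ `AnchoredCarrierAt 𝒪 n p 𝔄_pol (𝔄lg ∖ 𝔖)` — carriers, sides on the `θ`-ray, for the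
  ALGEBRAIC classes NOT served at each polarised abelian `n`-fold (with `(𝔄, 𝔖) = ∅`: PART Z-b §2); the CELL follows from two per-variety
  carrier statements, at and off the anchors (`lefAtExceptionalRegimeAt_of_anchoredCarrierAt_of_anchoredCarrierAt_offServed`).
* §2 NECESSARY (`exists_designModLefschetz_offServed_of_under_not_hasServedFibre`): the CONSTANT pencil `X × 𝔸¹`, `W := pr₁^*w`, `w` rational
  ALGEBRAIC non-Lefschetz served at NO `θ` on `X`, has no served fibre (anchor data transportable along isomorphisms), so the residual DEMANDS
  an `𝒪`-datum on SOME COPY of `X` with `κ_p = e^*(a·w + z)`, `a ≠ 0`, `z` algebraic Lefschetz, sides `(q,q)` — PART Z-c localised off `𝔖`.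
Displayed slack between §1 and §2: (i) Lefschetz classes at `s₀` (§1 serves them, §2 cannot test them); (ii) «unserved at `Θ|_{s₀}`» vs «served
at no `θ`»; (iii) which copy, and sides `(q,q)` vs on the `θ`-ray (as in PART Z-c / AA §1).

THE `(6,3)` PINNED INSTANCE (§3): (b″) ⟸ `AnchoredCarrierAt (tw C AdmTw) 6 3 𝔄_pol (𝔄lg ∖ 𝔖^pin)` ⟸ `PinnedDesignAt (tw C AdmTw) 6 3`; the
registered RUNG ⟸ (2a″) ∧ that statement (no pencil quantifier left); (b″) ⟹ a twisted design modulo Lefschetz classes on a copy of every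
abelian sixfold for every rational algebraic non-Lefschetz `(3,3)`-class that is a pinned secant–quotient Weil class at NO `θ`; and the
bookkeeping (b″) ⟺ (b′) ∧ the cell on the pencils served by v3's data only (`under_not_iff_under_not_and_under_sdiff`).

CHEAPEST OBSTRUCTION (§4–§5; hypotheses of `¬`-theorems, no new `def`). (O1, per variety) ONE abelian sixfold `X`, ONE rational algebraic
`w ∉ D³(X) ⊗ ℂ` nowhere pinned-served, NO `AdmTw`-twisted datum `κ₃ = e^*(a·w + z)` on any copy ⟹ ¬(b″) ⟹ ¬rung (⟹ ¬crux by the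
route-side `under_of_twAtDiag`, not imported here: this file stays outside the Theses cone). Candidates named
for the disprover, none cheap and none claimed: (β) a very general member of a SPLIT Weil-type sixfold family that is a chart of no `Y_d` (Weil
class algebraic in print, Markman Thm. 1.5.1, PREPRINT; a carrier plausible by deforming the secant sheaf, not in print as typed); (γ) odd-rank
product sub-loci (Abdulali: algebraic; carrier unknown); (δ) CM members of split families (algebraic by specialisation; semiregularity of the
limit sheaf not automatic). (O2, per pencil — the SEPARATING content (α)) on a residual pencil with ONE fibre of Picard number one in Hodge
form (a very general NON-SPLIT `(3, d, δ)` Weil-type pencil, `δ ∉ −N(K^×)`, van Geemen Thm. 4.11) the residual's datum is PINNED,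
`κ₃ = a·W|_{s₁} + c·(Θ³)|_{s₁}` EXACTLY at every fibre incl. split or CM ones (PART `LefschetzSlackPin`): ONE such pencil through an algebraic
fibre (a fibre where the Weil class is Lefschetz; or a CM fibre granted `HC_CM`) with NO pinned twisted datum at any fibre refutes (b″). «A
twisted semiregular sheaf with `κ₃` on the Weil line modulo `θ³` at SOME member of a very general non-split Weil-type sixfold pencil» is the
stub's irreducible content; print is silent there (the secant construction needs the split form) — neither proof nor refutation is cheap,
consistent with the PLAN-ONLY designation.

What is NOT claimed: (b″), (a″), (b′), any cell, the rung, the crux, K-SR♭∃, VHC, `HC_AV`, HC; that any candidate above IS an obstruction.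
References: [cite: Bloch1972Semiregularity, Remark (7.5)] [cite: BuchweitzFlenner2003, §5 Thm. 5.1] [cite: vanGeemen1994HodgeAV, §2.4,
Thm. 4.11, Lemma 5.2 and 5.4] [cite: Markman2025SecantWeil, Thm. 1.4.1, §1.5 and Thm. 1.5.1] [cite: VoisinHodgeI2002, Thm. 6.25, Thm. 7.10
and §7.1.2] [cite: DeligneHodgeII1971, Cor. 4.1.2 (proof)] [cite: Hartshorne1977, II.3 (p. 89) and II Ex. 4.9] [cite: Andre1996Motifs, §1.1 (p. 10)].
-/

noncomputable section

open CategoryTheory CategoryTheory.Limits AlgebraicGeometry Topology MonoidalCategory CartesianMonoidalCategory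

-- the cell's namespace repeats the summit name (`Summit.HodgeConjecture.HodgeConjecture…`), as in every `Ring2*` file
set_option linter.dupNamespace false

namespace Summit.HodgeConjecture.HodgeConjecture.Ring2.SemiregularRepresentatives

open Literature.AlgebraicGeometry Literature.AlgebraicGeometry.Motives
open Literature.AlgebraicGeometry.HodgeTheory
open Literature.AlgebraicTopology.SingularHomology
open Literature.Barriers.HodgeConjecture (divisorClassesSpan)
open Summit.Ventures.HSemireg (ObjClass)
open Summit.HodgeConjecture.HodgeConjecture.Ring2.Binders (exists_forall_isPolarizationClass_map_fiberι)

variable {𝒪 : ObjClass} {n p : ℕ}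
variable {𝔄 : ∀ X : SchemeOver ℂ, complexBetti X 2 → Prop} {𝔖 : ∀ (X : SchemeOver ℂ), complexBetti X 2 → Set (complexBetti X (2 * p))}

/-! ## §1 Sufficiency: the residual from the anchored carrier statement OFF the served classes (anchor-generic) -/

/-- **RESIDUAL ⟸ CARRIERS FOR THE UNSERVED ALGEBRAIC CLASSES** (door-, degree-, anchor-generic; fact-free). If at every polarised abelian
`n`-fold `(X, θ)` every rational ALGEBRAIC class `w` that is NOT `(𝔄, 𝔖)`-served at `(X, θ)` (`¬ (𝔄 X θ ∧ w ∈ 𝔖 X θ)`) has an `𝒪`-datum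
`κ_p = a·w + c_p·θᵖ`, `a ≠ 0`, `κ_q = c_q·θ^q` — the anchored-carrier statement of the COMPLEMENTARY anchor data — then the residual
`LefAtExceptionalRegimeAtUnder 𝒪 n p (¬ HasServedFibre n p 𝔄 𝔖)` holds: on a pencil with no `(𝔄, 𝔖)`-served fibre, polarise by the relative
hyperplane class `Θ`; the fibre `s₀` (where `W` is algebraic) IS served for the complementary data, and PART Z-b §5 transports the datum.
The residual is therefore a statement about ALGEBRAIC classes at ONE variety at a time, up to the slack recorded in the module docstring.
[cite: Bloch1972Semiregularity, Remark (7.5)] [cite: VoisinHodgeI2002, Thm. 6.25, Thm. 7.10 and §7.1.2] [cite: vanGeemen1994HodgeAV, §2.4] -/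
theorem under_not_hasServedFibre_of_anchoredCarrierAt_offServed
    (hA : AnchoredCarrierAt 𝒪 n p
      (fun X θ ↦ (∃ A : AbelianVariety ℂ, A.dim = n ∧ Nonempty (A.X ≅ X)) ∧ IsPolarizationClass n X θ)
      (fun X θ ↦ {w | w ∈ algebraicClasses X p ∧ ¬ (𝔄 X θ ∧ w ∈ 𝔖 X θ)})) :
    LefAtExceptionalRegimeAtUnder 𝒪 n p (fun _ _ f W ↦ ¬ HasServedFibre n p 𝔄 𝔖 f W) := by
  intro 𝒳 S f hf h𝒳 hirr haff hsm hdim hab hsec W hW s₀ halg hexc hns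
  haveI := haff
  haveI : IsSeparated S.hom := isSeparated_hom_of_isAffine S
  obtain ⟨Θ, hΘ⟩ := exists_forall_isPolarizationClass_map_fiberι f hf h𝒳
  have hΘQ : ∀ s : ComplexPoints S, IsRationalClass (complexBetti.map (fiberι f s) 2 Θ) := fun s ↦ (hΘ s).isRationalClass
  have hΘH : ∀ s : ComplexPoints S, IsOfHodgeType n (fiberOver f s) 2 1 1 (complexBetti.map (fiberι f s) 2 Θ) := fun s ↦
    isOfHodgeType_of_mem_algebraicClasses_of_isSmoothProjective (hf.isSmoothProjective s) 1 (hΘ s).mem_algebraicClasses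
  have hoff : ¬ (𝔄 (fiberOver f s₀) (complexBetti.map (fiberι f s₀) 2 Θ) ∧
      complexBetti.map (fiberι f s₀) (2 * p) W ∈ 𝔖 (fiberOver f s₀) (complexBetti.map (fiberι f s₀) 2 Θ)) :=
    fun h ↦ hns ⟨s₀, Θ, hΘQ, hΘH, h.1, h.2⟩
  have hsf : HasServedFibre n p
      (fun X θ ↦ (∃ A : AbelianVariety ℂ, A.dim = n ∧ Nonempty (A.X ≅ X)) ∧ IsPolarizationClass n X θ)
      (fun X θ ↦ {w | w ∈ algebraicClasses X p ∧ ¬ (𝔄 X θ ∧ w ∈ 𝔖 X θ)}) f W := by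
    refine ⟨s₀, Θ, hΘQ, hΘH, ⟨hab s₀, hΘ s₀⟩, ?_⟩
    rw [Set.mem_setOf_eq]
    exact ⟨halg, hoff⟩
  exact exists_lefAtDatum_of_anchoredCarrierAt hA hf W hW hsf

/-- **THE CELL FROM TWO PER-VARIETY CARRIER STATEMENTS** — at the anchors (`AnchoredCarrierAt 𝒪 n p 𝔄 𝔖`, the through-anchor piece) and OFF
them (the complementary statement of `under_not_hasServedFibre_of_anchoredCarrierAt_offServed`, the residual): no pencil-level hypothesis is
left. [cite: Bloch1972Semiregularity, Remark (7.5)] [cite: vanGeemen1994HodgeAV, §2.4 and Thm. 4.11] [cite: Markman2025SecantWeil, Thm. 1.4.1] -/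
theorem lefAtExceptionalRegimeAt_of_anchoredCarrierAt_of_anchoredCarrierAt_offServed (hA : AnchoredCarrierAt 𝒪 n p 𝔄 𝔖)
    (hB : AnchoredCarrierAt 𝒪 n p
      (fun X θ ↦ (∃ A : AbelianVariety ℂ, A.dim = n ∧ Nonempty (A.X ≅ X)) ∧ IsPolarizationClass n X θ)
      (fun X θ ↦ {w | w ∈ algebraicClasses X p ∧ ¬ (𝔄 X θ ∧ w ∈ 𝔖 X θ)})) :
    LefAtExceptionalRegimeAt 𝒪 n p :=
  lefAtExceptionalRegimeAt_of_anchoredCarrierAt_of_under_not hA (under_not_hasServedFibre_of_anchoredCarrierAt_offServed hB)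

/-- The complementary anchored-carrier statement follows from the PINNED DESIGN PROBLEM `PinnedDesignAt 𝒪 n p` (all polarised abelian
`n`-folds, all algebraic classes). [cite: Bloch1972Semiregularity, Remark (7.5)] [cite: Andre1996Motifs, §1.1 (p. 10)] -/
theorem anchoredCarrierAt_offServed_of_pinnedDesignAt (h : PinnedDesignAt 𝒪 n p) :
    AnchoredCarrierAt 𝒪 n p
      (fun X θ ↦ (∃ A : AbelianVariety ℂ, A.dim = n ∧ Nonempty (A.X ≅ X)) ∧ IsPolarizationClass n X θ)
      (fun X θ ↦ {w | w ∈ algebraicClasses X p ∧ ¬ (𝔄 X θ ∧ w ∈ 𝔖 X θ)}) :=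
  anchoredCarrierAt_of_pinnedDesignAt h (fun _ _ h ↦ h) fun _ _ _ _ hw ↦ hw.1

/-! ## §2 Necessity: the residual demands a design modulo Lefschetz classes OFF the served classes (anchor-generic; constant pencil) -/

/-- **THE RESIDUAL DEMANDS A CARRIER MODULO LEFSCHETZ CLASSES ON A COPY OF EVERY ABELIAN `n`-FOLD, FOR EVERY ALGEBRAIC NON-LEFSCHETZ
CLASS SERVED AT NO POLARISATION** (door-, degree-, anchor-generic; fact-free). Let the anchor data be transportable along isomorphisms
(`htr`, automatic for «`X` is isomorphic to …» predicates). For `X ≅` an abelian `n`-fold and `w` a rational ALGEBRAIC class with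
`w ∉ Dᵖ(X) ⊗ ℂ` such that `w ∉ 𝔖 X θ` at EVERY anchor structure `θ` on `X` (`hoff`), the CONSTANT pencil `pr₂ : X × 𝔸¹ ⟶ 𝔸¹` with
`W := pr₁^*w` satisfies every binder of the cell, the regime-2 hypotheses (algebraic at the origin, Lefschetz nowhere) AND has NO
`(𝔄, 𝔖)`-served fibre (a served fibre `(X × 𝔸¹)_s ≅ X` would transport to a served `(X, θ)`); so the residual
`LefAtExceptionalRegimeAtUnder 𝒪 n p (¬ HasServedFibre n p 𝔄 𝔖)` returns an `𝒪`-datum on a slice: SOME COPY `e : X' ≅ X`, `κ_p = e^*(a·w + z)`,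
`a ≠ 0`, `z` an algebraic Lefschetz class of `X`, every `κ_q` of type `(q,q)` — `DesignModLefschetzAt 𝒪 n p` LOCALISED off the served classes
(PART Z-c's argument verbatim with the served fibre replaced by its absence). [cite: Bloch1972Semiregularity, Remark (7.5)]
[cite: vanGeemen1994HodgeAV, §2.4 and Thm. 4.11] [cite: Hartshorne1977, II.3 (p. 89) and II Ex. 4.9] -/
theorem exists_designModLefschetz_offServed_of_under_not_hasServedFibre
    (h : LefAtExceptionalRegimeAtUnder 𝒪 n p (fun _ _ f W ↦ ¬ HasServedFibre n p 𝔄 𝔖 f W))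
    (htr : ∀ ⦃X X' : SchemeOver ℂ⦄ (e : X ≅ X') (θ : complexBetti X 2) (w : complexBetti X (2 * p)), 𝔄 X θ → w ∈ 𝔖 X θ →
      𝔄 X' (complexBetti.map e.inv 2 θ) ∧ complexBetti.map e.inv (2 * p) w ∈ 𝔖 X' (complexBetti.map e.inv 2 θ))
    (X : SchemeOver ℂ) (hXab : ∃ A : AbelianVariety ℂ, A.dim = n ∧ Nonempty (A.X ≅ X))
    (w : complexBetti X (2 * p)) (hwQ : IsRationalClass w) (hwalg : w ∈ algebraicClasses X p)
    (hwD : w ∉ divisorClassesSpan X n p) (hoff : ∀ θ : complexBetti X 2, 𝔄 X θ → w ∉ 𝔖 X θ) :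
    ∃ (X' : SchemeOver ℂ) (e : X' ≅ X) (I : Finset ℕ) (κ : (q : ℕ) → complexBetti X' (2 * q)) (a : ℂ) (z : complexBetti X (2 * p)),
      p ∈ I ∧ 𝒪 n X' I κ ∧ a ≠ 0 ∧ z ∈ algebraicClasses X p ∧ z ∈ divisorClassesSpan X n p ∧
      κ p = complexBetti.map e.hom (2 * p) (a • w + z) ∧ ∀ q ∈ I, IsOfHodgeType n X' (2 * q) q q (κ q) := by
  obtain ⟨A, hA, ⟨eA⟩⟩ := hXab
  have hAX : IsSmoothProjective n A.X := hA ▸ AbelianVariety.isSmoothProjective_holds (A := A)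
  have hX : IsSmoothProjective n X := hAX.of_iso eA
  have hwH : IsOfHodgeType n X (2 * p) p p w := isOfHodgeType_of_mem_algebraicClasses_of_isSmoothProjective hX p hwalg
  -- the base `C = 𝔸¹`
  haveI : IrreducibleSpace (specOver ℂ (MvPolynomial (Fin 1) ℂ)).left := irreducibleSpace_affineLine_left
  haveI : IsAffine (specOver ℂ (MvPolynomial (Fin 1) ℂ)).left := isAffine_affineLine_left
  obtain ⟨s₀⟩ := nonempty_complexPoints_affineLine
  -- the constant pencil and its binders
  have hf : IsSmoothProjectiveFamily (snd X (specOver ℂ (MvPolynomial (Fin 1) ℂ))) n :=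
    isSmoothProjectiveFamily_snd hX _
  have h𝒳 : IsQuasiProjectiveOver (X ⊗ specOver ℂ (MvPolynomial (Fin 1) ℂ)) :=
    isQuasiProjectiveOver_tensor_of_isProjectiveOver hX.isProjectiveOver isQuasiProjectiveOver_affineLine
  have habel : ∀ s : ComplexPoints (specOver ℂ (MvPolynomial (Fin 1) ℂ)),
      ∃ A' : AbelianVariety ℂ, A'.dim = n ∧ Nonempty (A'.X ≅ fiberOver (snd X (specOver ℂ (MvPolynomial (Fin 1) ℂ))) s) :=
    fun s ↦ ⟨A, hA, ⟨eA ≪≫ sliceFiberIso X s⟩⟩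
  -- the class `W := pr₁^* w` and its restrictions
  have hres := fun s : ComplexPoints (specOver ℂ (MvPolynomial (Fin 1) ℂ)) ↦ map_fiberι_map_fst_eq s (2 * p) w
  have hW : ∀ s : ComplexPoints (specOver ℂ (MvPolynomial (Fin 1) ℂ)),
      IsRationalClass (complexBetti.map (fiberι (snd X _) s) (2 * p) (complexBetti.map (fst X _) (2 * p) w)) ∧
        IsOfHodgeType n (fiberOver (snd X _) s) (2 * p) p p
          (complexBetti.map (fiberι (snd X _) s) (2 * p) (complexBetti.map (fst X _) (2 * p) w)) := by
    intro s
    rw [hres s]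
    exact ⟨(isRationalClass_map_iff_of_iso (sliceFiberIso X s).symm).2 hwQ,
      (isOfHodgeType_map_iff_of_iso (sliceFiberIso X s).symm).2 hwH⟩
  have hWs₀ : complexBetti.map (fiberι (snd X _) s₀) (2 * p) (complexBetti.map (fst X _) (2 * p) w) ∈
      algebraicClasses (fiberOver (snd X (specOver ℂ (MvPolynomial (Fin 1) ℂ))) s₀) p := by
    rw [hres s₀]
    exact (mem_algebraicClasses_map_iff_of_iso (sliceFiberIso X s₀).symm).2 hwalg
  have hexc : ¬ ∀ s : ComplexPoints (specOver ℂ (MvPolynomial (Fin 1) ℂ)),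
      complexBetti.map (fiberι (snd X _) s) (2 * p) (complexBetti.map (fst X _) (2 * p) w) ∈
          algebraicClasses (fiberOver (snd X _) s) p ∧
        complexBetti.map (fiberι (snd X _) s) (2 * p) (complexBetti.map (fst X _) (2 * p) w) ∈
          divisorClassesSpan (fiberOver (snd X _) s) n p := by
    intro hall
    obtain ⟨-, hD⟩ := hall s₀
    apply hwD
    have hback := map_mem_divisorClassesSpan hX (hf.isSmoothProjective s₀) (sliceFiberIso X s₀).hom hD
    rwa [hres s₀, (sliceFiberIso X s₀).complexBetti_map_hom_map_inv] at hback
  -- the constant pencil has NO served fibre: a served fibre `(X × 𝔸¹)_{sₐ} ≅ X` would transport to a served structure on `X`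
  have hns : ¬ HasServedFibre n p 𝔄 𝔖 (snd X (specOver ℂ (MvPolynomial (Fin 1) ℂ))) (complexBetti.map (fst X _) (2 * p) w) := by
    rintro ⟨sₐ, Θ, -, -, hanc, hserved⟩
    have ht := htr (sliceFiberIso X sₐ).symm _ _ hanc hserved
    rw [Iso.symm_inv, hres sₐ, (sliceFiberIso X sₐ).complexBetti_map_hom_map_inv] at ht
    exact hoff _ ht.1 ht.2
  obtain ⟨s₁, I, κ, V, a, Z, hpI, h𝒪, ha, hZ, hV, hκV, hVH⟩ :=
    h (snd X _) hf h𝒳 irreducibleSpace_affineLine_left isAffine_affineLine_left smooth_affineLine_hom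
      topologicalKrullDim_affineLine_left habel (exists_section_snd A eA _) _ hW s₀ hWs₀ hexc hns
  refine ⟨fiberOver (snd X _) s₁, (sliceFiberIso X s₁).symm, I, κ, a,
    complexBetti.map (sliceFiberIso X s₁).hom (2 * p) (complexBetti.map (fiberι (snd X _) s₁) (2 * p) Z),
    hpI, h𝒪, ha, ?_, ?_, ?_, fun q hq ↦ ?_⟩
  · exact (mem_algebraicClasses_map_iff_of_iso (sliceFiberIso X s₁)).2 (hZ s₁).1
  · exact map_mem_divisorClassesSpan hX (hf.isSmoothProjective s₁) (sliceFiberIso X s₁).hom (hZ s₁).2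
  · rw [hκV p hpI, hV, map_add, map_smul, hres s₁, Iso.symm_hom, map_add, map_smul,
      (sliceFiberIso X s₁).complexBetti_map_inv_map_hom]
  · rw [hκV q hq]
    exact hVH q hq s₁

/-! ## §3 The pinned `(6,3)` residual of crux 19787: the sandwich instantiated at `(𝔄^pin, 𝔖^pin)` -/

/-- **(b″) ⟸ TWISTED CARRIERS FOR THE ALGEBRAIC CLASSES THAT ARE NOT PINNED-SERVED.** If at every polarised abelian sixfold `(X, θ)` every
rational algebraic `(3,3)`-class `w ∉ 𝔖^pin X θ` has an `AdmTw`-admissible `B`-twisted datum `κ₃ = a·w + c₃·θ³`, `a ≠ 0`, `κ_k = c_k·θᵏ`, then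
`SecantQuotientResidual63Pinned C` (the registered stub 2b″'s statement at `C`) holds. (A pinned-served class carries its anchor:
`w ∈ 𝔖^pin X θ → 𝔄^pin X θ`, so «not `(𝔄^pin, 𝔖^pin)`-served» is «`∉ 𝔖^pin`».) [cite: Bloch1972Semiregularity, Remark (7.5)]
[cite: Markman2025SecantWeil, Thm. 1.4.1 and §1.5] [cite: VoisinHodgeI2002, Thm. 6.25 and Thm. 7.10] -/
theorem secantQuotientResidual63Pinned_of_anchoredCarrierAt_algebraic_offPinned {C : ChernCharacterBetti}
    (hB : AnchoredCarrierAt (Literature.AlgebraicGeometry.HodgeTheory.twistedReflexiveClass C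
        (fun n X₀ I E => Summit.Ventures.HSemireg.gluableSigmaAdmissible n X₀ I E ∨
          Literature.AlgebraicGeometry.HodgeTheory.bfSingleAdmissible n X₀ I E)) 6 3
      (fun X θ ↦ (∃ A : AbelianVariety ℂ, A.dim = 6 ∧ Nonempty (A.X ≅ X)) ∧ IsPolarizationClass 6 X θ)
      (fun X θ ↦ {w | w ∈ algebraicClasses X 3 ∧ w ∉ secantQuotientServedClassesPinned X θ})) :
    SecantQuotientResidual63Pinned C := by
  refine under_not_hasServedFibre_of_anchoredCarrierAt_offServed (anchoredCarrierAt_anti (fun _ _ h ↦ h) (fun X θ _ w hw ↦ ?_) hB)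
  exact ⟨hw.1, fun h ↦ hw.2 ⟨secantQuotientAnchorsPinned_of_mem h, h⟩⟩

/-- **(b″) ⟸ the pinned design problem `PinnedDesignAt (tw C AdmTw) 6 3`** (all algebraic classes at all polarised abelian sixfolds) — the
coarsest per-variety sufficient condition. [cite: Bloch1972Semiregularity, Remark (7.5)] [cite: Andre1996Motifs, §1.1 (p. 10)] -/
theorem secantQuotientResidual63Pinned_of_pinnedDesignAt {C : ChernCharacterBetti}
    (h : PinnedDesignAt (Literature.AlgebraicGeometry.HodgeTheory.twistedReflexiveClass C
        (fun n X₀ I E => Summit.Ventures.HSemireg.gluableSigmaAdmissible n X₀ I E ∨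
          Literature.AlgebraicGeometry.HodgeTheory.bfSingleAdmissible n X₀ I E)) 6 3) :
    SecantQuotientResidual63Pinned C :=
  secantQuotientResidual63Pinned_of_anchoredCarrierAt_algebraic_offPinned
    (anchoredCarrierAt_of_pinnedDesignAt h (fun _ _ h ↦ h) fun _ _ _ _ hw ↦ hw.1)

/-- **THE RUNG FROM TWO PER-VARIETY CARRIER STATEMENTS**: (2a″) `SecantQuotientAnchorCarrier63Pinned C` (pinned-served classes at pinned
anchors) ∧ the complementary statement (algebraic classes NOT pinned-served, at all polarised abelian sixfolds) ⟹ the registered `(6,3)`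
rung `LefAtExceptionalRegimeSixfoldMiddle (tw C AdmTw)` — stub 2b″ replaced by a per-variety statement, no pencil quantifier left.
[cite: Markman2025SecantWeil, Thm. 1.4.1 and Thm. 1.5.1] [cite: Bloch1972Semiregularity, Remark (7.5)] [cite: vanGeemen1994HodgeAV, Thm. 4.11] -/
theorem rung_sixfoldMiddleTw_of_anchorCarrier63Pinned_of_anchoredCarrierAt_algebraic_offPinned {C : ChernCharacterBetti}
    (hA : SecantQuotientAnchorCarrier63Pinned C)
    (hB : AnchoredCarrierAt (Literature.AlgebraicGeometry.HodgeTheory.twistedReflexiveClass C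
        (fun n X₀ I E => Summit.Ventures.HSemireg.gluableSigmaAdmissible n X₀ I E ∨
          Literature.AlgebraicGeometry.HodgeTheory.bfSingleAdmissible n X₀ I E)) 6 3
      (fun X θ ↦ (∃ A : AbelianVariety ℂ, A.dim = 6 ∧ Nonempty (A.X ≅ X)) ∧ IsPolarizationClass 6 X θ)
      (fun X θ ↦ {w | w ∈ algebraicClasses X 3 ∧ w ∉ secantQuotientServedClassesPinned X θ})) :
    LefAtExceptionalRegimeSixfoldMiddle (Literature.AlgebraicGeometry.HodgeTheory.twistedReflexiveClass C
      (fun n X₀ I E => Summit.Ventures.HSemireg.gluableSigmaAdmissible n X₀ I E ∨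
        Literature.AlgebraicGeometry.HodgeTheory.bfSingleAdmissible n X₀ I E)) :=
  lefAtExceptionalRegimeSixfoldMiddle_of_anchoredCarrierAt_of_under_not hA
    (secantQuotientResidual63Pinned_of_anchoredCarrierAt_algebraic_offPinned hB)

/-- **(b″) ⟹ A TWISTED DESIGN MODULO LEFSCHETZ CLASSES ON A COPY OF EVERY ABELIAN SIXFOLD, FOR EVERY RATIONAL ALGEBRAIC NON-LEFSCHETZ
`(3,3)`-CLASS THAT IS A PINNED SECANT–QUOTIENT WEIL CLASS AT NO POLARISATION** (the necessary per-variety content of stub 2b″; transport of the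
pinned anchor data is `secantQuotientPinned_transport`). [cite: Bloch1972Semiregularity, Remark (7.5)] [cite: vanGeemen1994HodgeAV, §2.4 and Thm. 4.11]
[cite: Markman2025SecantWeil, Thm. 1.4.1 and §1.5] [cite: Hartshorne1977, II.3 (p. 89)] -/
theorem exists_designModLefschetz_offPinned_of_secantQuotientResidual63Pinned {C : ChernCharacterBetti}
    (h : SecantQuotientResidual63Pinned C) (X : SchemeOver ℂ) (hXab : ∃ A : AbelianVariety ℂ, A.dim = 6 ∧ Nonempty (A.X ≅ X))
    (w : complexBetti X (2 * 3)) (hwQ : IsRationalClass w) (hwalg : w ∈ algebraicClasses X 3)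
    (hwD : w ∉ divisorClassesSpan X 6 3) (hoff : ∀ θ : complexBetti X 2, ¬ IsSecantQuotientWeilClassAtPinned X θ w) :
    ∃ (X' : SchemeOver ℂ) (e : X' ≅ X) (I : Finset ℕ) (κ : (q : ℕ) → complexBetti X' (2 * q)) (a : ℂ) (z : complexBetti X (2 * 3)),
      3 ∈ I ∧ Literature.AlgebraicGeometry.HodgeTheory.twistedReflexiveClass C
        (fun n X₀ I E => Summit.Ventures.HSemireg.gluableSigmaAdmissible n X₀ I E ∨
          Literature.AlgebraicGeometry.HodgeTheory.bfSingleAdmissible n X₀ I E) 6 X' I κ ∧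
      a ≠ 0 ∧ z ∈ algebraicClasses X 3 ∧ z ∈ divisorClassesSpan X 6 3 ∧
      κ 3 = complexBetti.map e.hom (2 * 3) (a • w + z) ∧ ∀ q ∈ I, IsOfHodgeType 6 X' (2 * q) q q (κ q) :=
  exists_designModLefschetz_offServed_of_under_not_hasServedFibre h secantQuotientPinned_transport X hXab w hwQ hwalg hwD
    fun θ _ hw ↦ hoff θ hw

/-- **BOOKKEEPING (the slice the pin adds): (b″) ⟺ (b′) ∧ the cell on the pencils served by v3's anchor data but NOT by the pinned data**
(«served only at an un-pinned polarisation», case (ζ) of the line card) — pure logic (`under_not_iff_under_not_and_under_sdiff` at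
`𝔄^pin ≤ 𝔄`, `𝔖^pin ⊆ 𝔖`). [cite: Bloch1972Semiregularity, Remark (7.5)] [cite: Markman2025SecantWeil, Thm. 1.4.1 and §2.4 Prop. 2.4.4] -/
theorem secantQuotientResidual63Pinned_iff_residual63_and_under_unpinnedServed {C : ChernCharacterBetti} :
    SecantQuotientResidual63Pinned C ↔ SecantQuotientResidual63 C ∧
      LefAtExceptionalRegimeAtUnder (Literature.AlgebraicGeometry.HodgeTheory.twistedReflexiveClass C
        (fun n X₀ I E => Summit.Ventures.HSemireg.gluableSigmaAdmissible n X₀ I E ∨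
          Literature.AlgebraicGeometry.HodgeTheory.bfSingleAdmissible n X₀ I E)) 6 3
        (fun _ _ f W ↦ HasServedFibre 6 3 (fun X θ ↦ secantQuotientAnchors X θ) (fun X θ ↦ secantQuotientServedClasses X θ) f W ∧
          ¬ HasServedFibre 6 3 (fun X θ ↦ secantQuotientAnchorsPinned X θ)
            (fun X θ ↦ secantQuotientServedClassesPinned X θ) f W) :=
  under_not_iff_under_not_and_under_sdiff secantQuotientAnchors_of_pinned secantQuotientServedClasses_of_pinned

/-! ## §4 The cheapest obstruction, per variety: ONE unserved algebraic exceptional class with no twisted design refutes (b″) and the rung -/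

/-- **OBSTRUCTION (O1) TO STUB 2b″, PER VARIETY.** ONE abelian sixfold `X`, ONE rational algebraic `(3,3)`-class `w ∉ D³(X) ⊗ ℂ` that is a
pinned secant–quotient Weil class at NO `θ`, such that NO copy `e : X' ≅ X` carries an `AdmTw`-admissible `B`-twisted datum `(I ∋ 3, κ)` with
`κ₃ = e^*(a·w + z)`, `a ≠ 0`, `z` an algebraic Lefschetz class, sides `(q,q)` ⟹ `¬ SecantQuotientResidual63Pinned C`. Candidate `(X, w)`
(NOT claimed to obstruct): a very general member of a split Weil-type sixfold family that is a chart of no `Y_d` (Weil class algebraic in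
print, PREPRINT), an odd-rank product sub-locus member, a CM member of a split family. [cite: vanGeemen1994HodgeAV, Thm. 4.11 and §5.4]
[cite: Markman2025SecantWeil, Thm. 1.5.1] [cite: Bloch1972Semiregularity, Remark (7.5)] -/
theorem not_secantQuotientResidual63Pinned_of_offPinned_noDesign {C : ChernCharacterBetti}
    (X : SchemeOver ℂ) (hXab : ∃ A : AbelianVariety ℂ, A.dim = 6 ∧ Nonempty (A.X ≅ X))
    (w : complexBetti X (2 * 3)) (hwQ : IsRationalClass w) (hwalg : w ∈ algebraicClasses X 3)
    (hwD : w ∉ divisorClassesSpan X 6 3) (hoff : ∀ θ : complexBetti X 2, ¬ IsSecantQuotientWeilClassAtPinned X θ w)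
    (hno : ∀ (X' : SchemeOver ℂ) (e : X' ≅ X) (I : Finset ℕ) (κ : (q : ℕ) → complexBetti X' (2 * q)) (a : ℂ)
      (z : complexBetti X (2 * 3)), 3 ∈ I →
      Literature.AlgebraicGeometry.HodgeTheory.twistedReflexiveClass C
        (fun n X₀ I E => Summit.Ventures.HSemireg.gluableSigmaAdmissible n X₀ I E ∨
          Literature.AlgebraicGeometry.HodgeTheory.bfSingleAdmissible n X₀ I E) 6 X' I κ →
      a ≠ 0 → z ∈ algebraicClasses X 3 → z ∈ divisorClassesSpan X 6 3 →
      κ 3 = complexBetti.map e.hom (2 * 3) (a • w + z) → (∀ q ∈ I, IsOfHodgeType 6 X' (2 * q) q q (κ q)) → False) :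
    ¬ SecantQuotientResidual63Pinned C := by
  intro h
  obtain ⟨X', e, I, κ, a, z, hpI, h𝒪, ha, hzalg, hzD, hκ, hH⟩ :=
    exists_designModLefschetz_offPinned_of_secantQuotientResidual63Pinned h X hXab w hwQ hwalg hwD hoff
  exact hno X' e I κ a z hpI h𝒪 ha hzalg hzD hκ hH

/-- **Any refutation of (b″) refutes the registered `(6,3)` rung** (the rung returns (b″) fact-free,
`secantQuotientResidual63Pinned_of_rung_sixfoldMiddleTw`) — so (O1) above and (O2) below are obstructions to the rung, hence to the crux
`SemiregularSheafRepresentativesTwAtDiag` (route side: `VHCAbelianSchemesRoadServedFibreItems.under_of_twAtDiag`).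
[cite: Markman2025SecantWeil, Thm. 1.5.1] [cite: Bloch1972Semiregularity, Remark (7.5)] -/
theorem not_rung_sixfoldMiddleTw_of_not_secantQuotientResidual63Pinned {C : ChernCharacterBetti} (h : ¬ SecantQuotientResidual63Pinned C) :
    ¬ LefAtExceptionalRegimeSixfoldMiddle (Literature.AlgebraicGeometry.HodgeTheory.twistedReflexiveClass C
      (fun n X₀ I E => Summit.Ventures.HSemireg.gluableSigmaAdmissible n X₀ I E ∨
        Literature.AlgebraicGeometry.HodgeTheory.bfSingleAdmissible n X₀ I E)) :=
  fun hr ↦ h (secantQuotientResidual63Pinned_of_rung_sixfoldMiddleTw hr)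

/-! ## §5 The cheapest obstruction, per pencil (the separating content): on a residual pencil with ONE Picard-rank-one fibre the datum is PINNED -/

variable {𝒳 S : SchemeOver ℂ} {f : 𝒳 ⟶ S}

/-- **ON A RESIDUAL PENCIL WITH A PICARD-RANK-ONE FIBRE, (b″) DELIVERS A PINNED TWISTED DATUM.** `f : 𝒳 ⟶ S` a one-parameter abelian sixfold
scheme of the cell's shape, `W` fibrewise rational `(3,3)`, algebraic at `s'`, not algebraic-Lefschetz everywhere, with NO pinned-served fibre,
`Θ ∈ H²(𝒳(ℂ); ℂ)` ANY global class and `s♯` a fibre at which every rational `(1,1)`-class lies on `ℂ·Θ|_{s♯}` (a very general NON-SPLIT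
`(3, d, δ)` Weil-type pencil: van Geemen Thm. 4.11 / Lemma 5.2). Then `SecantQuotientResidual63Pinned C` gives SOME fibre `s₁`, degrees
`I ∋ 3`, an `AdmTw`-admissible `κ` with **`κ₃ = a·W|_{s₁} + c·(Θ³)|_{s₁}` EXACTLY**, `a ≠ 0`, and `V₃ ≡ a·W + c·Θ³` on EVERY fibre: the
Lefschetz slack is the scalar `c` (PART `LefschetzSlackPin`, `pinned_of_lefAtDatum`), even at a split or CM fibre of the pencil. Conversely a
pinned datum at ONE fibre w.r.t. a `Θ` with `(Θ³)|` algebraic settles the pencil (`lefAtDatum_of_pinned`): on such pencils stub 2b″ IS the pinned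
twisted design problem at some member, up to the side-degree slack.
[cite: vanGeemen1994HodgeAV, Thm. 4.11, §2.4 and Lemma 5.2] [cite: DeligneHodgeII1971, Cor. 4.1.2 (proof)] [cite: Bloch1972Semiregularity, Remark (7.5)] -/
theorem exists_pinned_of_secantQuotientResidual63Pinned {C : ChernCharacterBetti} (h : SecantQuotientResidual63Pinned C)
    (hf : IsSmoothProjectiveFamily f 6) (h𝒳 : IsQuasiProjectiveOver 𝒳) (hirr : IrreducibleSpace S.left) (haff : IsAffine S.left)
    (hsm : AlgebraicGeometry.Smooth S.hom) (hdim : topologicalKrullDim S.left = 1)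
    (habel : ∀ s : ComplexPoints S, ∃ A' : AbelianVariety ℂ, A'.dim = 6 ∧ Nonempty (A'.X ≅ fiberOver f s))
    (he : ∃ e : S ⟶ 𝒳, e ≫ f = 𝟙 S) (W : complexBetti 𝒳 (2 * 3))
    (hW : ∀ s : ComplexPoints S, IsRationalClass (complexBetti.map (fiberι f s) (2 * 3) W) ∧
      IsOfHodgeType 6 (fiberOver f s) (2 * 3) 3 3 (complexBetti.map (fiberι f s) (2 * 3) W))
    (s' : ComplexPoints S) (hs' : complexBetti.map (fiberι f s') (2 * 3) W ∈ algebraicClasses (fiberOver f s') 3)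
    (hexc : ¬ ∀ s : ComplexPoints S,
      complexBetti.map (fiberι f s) (2 * 3) W ∈ algebraicClasses (fiberOver f s) 3 ∧
      complexBetti.map (fiberι f s) (2 * 3) W ∈ divisorClassesSpan (fiberOver f s) 6 3)
    (hns : ¬ HasServedFibre 6 3 (fun X θ ↦ secantQuotientAnchorsPinned X θ) (fun X θ ↦ secantQuotientServedClassesPinned X θ) f W)
    (Θ : complexBetti 𝒳 2) {s₀ : ComplexPoints S}
    (hpic : ∀ b : complexBetti (fiberOver f s₀) 2, IsRationalClass b → IsOfHodgeType 6 (fiberOver f s₀) 2 1 1 b →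
      b ∈ ℂ ∙ complexBetti.map (fiberι f s₀) 2 Θ) :
    ∃ (s₁ : ComplexPoints S) (I : Finset ℕ) (κ : (q : ℕ) → complexBetti (fiberOver f s₁) (2 * q))
      (V : (q : ℕ) → complexBetti 𝒳 (2 * q)) (a c : ℂ),
      3 ∈ I ∧ Literature.AlgebraicGeometry.HodgeTheory.twistedReflexiveClass C
        (fun n X₀ I E => Summit.Ventures.HSemireg.gluableSigmaAdmissible n X₀ I E ∨
          Literature.AlgebraicGeometry.HodgeTheory.bfSingleAdmissible n X₀ I E) 6 (fiberOver f s₁) I κ ∧ a ≠ 0 ∧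
      κ 3 = a • complexBetti.map (fiberι f s₁) (2 * 3) W + c • complexBetti.map (fiberι f s₁) (2 * 3) (cupPowTwo Θ 3) ∧
      (∀ s : ComplexPoints S, complexBetti.map (fiberι f s) (2 * 3) (V 3) =
        a • complexBetti.map (fiberι f s) (2 * 3) W + c • complexBetti.map (fiberι f s) (2 * 3) (cupPowTwo Θ 3)) ∧
      (∀ q ∈ I, κ q = complexBetti.map (fiberι f s₁) (2 * q) (V q)) ∧
      (∀ q ∈ I, ∀ s : ComplexPoints S, IsOfHodgeType 6 (fiberOver f s) (2 * q) q q (complexBetti.map (fiberι f s) (2 * q) (V q))) := by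
  obtain ⟨s₁, I, κ, V, a, Z, hpI, hκ, ha, hZ, hVp, hκV, hVH⟩ := h f hf h𝒳 hirr haff hsm hdim habel he W hW s' hs' hexc hns
  obtain ⟨c, hV, hκp⟩ := pinned_of_lefAtDatum hf hirr hsm Θ hpic W Z (V 3) a (κ 3) hVp (hκV 3 hpI) fun s ↦ (hZ s).2
  exact ⟨s₁, I, κ, V, a, c, hpI, hκ, ha, hκp, hV, hκV, hVH⟩

/-- **OBSTRUCTION (O2) TO STUB 2b″, PER PENCIL — THE SEPARATING CONTENT.** ONE one-parameter abelian sixfold scheme of the cell's shape with a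
somewhere-exceptional fibrewise rational `(3,3)` class `W` algebraic at `s'`, NO pinned-served fibre, a global class `Θ` and ONE fibre of Picard
number one in Hodge form w.r.t. `Θ|`, on which NO fibre `s₁` carries an `AdmTw`-admissible `B`-twisted datum with `κ₃ = a·W|_{s₁} + c·(Θ³)|_{s₁}`,
`a ≠ 0` (sides restricted from fibrewise-`(q,q)` global classes) ⟹ `¬ SecantQuotientResidual63Pinned C`. THE attack surface of record: a very
general NON-SPLIT Weil-type sixfold pencil through a fibre where the Weil class is algebraic (a fibre where it is Lefschetz, or a CM fibre
granted `HC_CM`), asking for a twisted semiregular sheaf with `κ₃` on the Weil line modulo `θ³` at SOME member — print is silent there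
(Markman's secant construction needs the split form); neither cheap to prove nor to refute. [cite: vanGeemen1994HodgeAV, Thm. 4.11 and Lemma 5.2]
[cite: Markman2025SecantWeil, Thm. 1.5.1 and §1.5] [cite: DeligneHodgeII1971, Cor. 4.1.2 (proof)] [cite: Bloch1972Semiregularity, Remark (7.5)] -/
theorem not_secantQuotientResidual63Pinned_of_residualPencil_noPinnedDatum {C : ChernCharacterBetti}
    (hf : IsSmoothProjectiveFamily f 6) (h𝒳 : IsQuasiProjectiveOver 𝒳) (hirr : IrreducibleSpace S.left) (haff : IsAffine S.left)
    (hsm : AlgebraicGeometry.Smooth S.hom) (hdim : topologicalKrullDim S.left = 1)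
    (habel : ∀ s : ComplexPoints S, ∃ A' : AbelianVariety ℂ, A'.dim = 6 ∧ Nonempty (A'.X ≅ fiberOver f s))
    (he : ∃ e : S ⟶ 𝒳, e ≫ f = 𝟙 S) (W : complexBetti 𝒳 (2 * 3))
    (hW : ∀ s : ComplexPoints S, IsRationalClass (complexBetti.map (fiberι f s) (2 * 3) W) ∧
      IsOfHodgeType 6 (fiberOver f s) (2 * 3) 3 3 (complexBetti.map (fiberι f s) (2 * 3) W))
    (s' : ComplexPoints S) (hs' : complexBetti.map (fiberι f s') (2 * 3) W ∈ algebraicClasses (fiberOver f s') 3)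
    (hexc : ¬ ∀ s : ComplexPoints S,
      complexBetti.map (fiberι f s) (2 * 3) W ∈ algebraicClasses (fiberOver f s) 3 ∧
      complexBetti.map (fiberι f s) (2 * 3) W ∈ divisorClassesSpan (fiberOver f s) 6 3)
    (hns : ¬ HasServedFibre 6 3 (fun X θ ↦ secantQuotientAnchorsPinned X θ) (fun X θ ↦ secantQuotientServedClassesPinned X θ) f W)
    (Θ : complexBetti 𝒳 2) {s₀ : ComplexPoints S}
    (hpic : ∀ b : complexBetti (fiberOver f s₀) 2, IsRationalClass b → IsOfHodgeType 6 (fiberOver f s₀) 2 1 1 b →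
      b ∈ ℂ ∙ complexBetti.map (fiberι f s₀) 2 Θ)
    (hno : ∀ (s₁ : ComplexPoints S) (I : Finset ℕ) (κ : (q : ℕ) → complexBetti (fiberOver f s₁) (2 * q))
      (V : (q : ℕ) → complexBetti 𝒳 (2 * q)) (a c : ℂ), 3 ∈ I →
      Literature.AlgebraicGeometry.HodgeTheory.twistedReflexiveClass C
        (fun n X₀ I E => Summit.Ventures.HSemireg.gluableSigmaAdmissible n X₀ I E ∨
          Literature.AlgebraicGeometry.HodgeTheory.bfSingleAdmissible n X₀ I E) 6 (fiberOver f s₁) I κ → a ≠ 0 →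
      κ 3 = a • complexBetti.map (fiberι f s₁) (2 * 3) W + c • complexBetti.map (fiberι f s₁) (2 * 3) (cupPowTwo Θ 3) →
      (∀ q ∈ I, κ q = complexBetti.map (fiberι f s₁) (2 * q) (V q)) →
      (∀ q ∈ I, ∀ s : ComplexPoints S, IsOfHodgeType 6 (fiberOver f s) (2 * q) q q (complexBetti.map (fiberι f s) (2 * q) (V q))) →
      False) :
    ¬ SecantQuotientResidual63Pinned C := by
  intro h
  obtain ⟨s₁, I, κ, V, a, c, hpI, hκ, ha, hκp, -, hκV, hVH⟩ :=
    exists_pinned_of_secantQuotientResidual63Pinned h hf h𝒳 hirr haff hsm hdim habel he W hW s' hs' hexc hns Θ hpic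
  exact hno s₁ I κ V a c hpI hκ ha hκp hκV hVH

end Summit.HodgeConjecture.HodgeConjecture.Ring2.SemiregularRepresentatives

end
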